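/-
Copyright (c) 2026 the pub-hodgecm-mathlib formalisation cell (harness21).  Prover seat hodgecm-mathlib-K2Liu-p09 (g2): Track B «K2-LIT»,
#184♮ = hLiu418 = stmt-HodgeConjecture-24832, unit U3a of the K2_Liu road: SOCKET #15b `sig_K2LiuSiegelDeltaHeightCount` PAID BY NAME; 2026-09-04.
-/
import Summits.HodgeConjecture.HodgeConjecture.Theorems.K2LiuSiegelEisensteinDoubledSummable   -- ★ p856279 (K2Liu-p09 g0): `parabolicIntegral` (E5′) + the whole ★ Godement chain
import HarnessLib

/-!
# Crux `HLiu418`, Track B road `K2_Liu`, unit U3a «SIEGEL EISENSTEIN SERIES», socket #15b: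
# `sig_K2LiuSiegelDeltaHeightCount` — GODEMENT'S COUNT for EVERY height of type `(P_Δ, |det_Δ|^{1/2})`, PAID BY NAME

Cell `hodgecm-mathlib`, crux item hLiu418 = `stmt-HodgeConjecture-24832`; squad K2 ∕ K2Liu, prover K2Liu-p09 (g2).  THEOREMS ONLY; lane
`--supports stmt-HodgeConjecture-24832` (socket #15b of `Cruxes/HLiu418/Lines/K2_Liu_CurveThetaSigs_U3a_SiegelEisenstein.lean` ED. 4 :167,
type VERBATIM; OWNER K2Liu-p09 lineage, statement re-typed ED. 3 on this lineage's words: NO measurability ∕ continuity of `Φ`).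

THE STATEMENT.  `H = U(𝕍 ⊕ −𝕍)(𝔸)` the doubled unitary group of the CM datum of record (★ `GRConstruction.HA`), `P_Δ = ` the Siegel parabolic
(★ `IsSiegelDelta`), `modDelta p = |det_Δ p|_{𝔸_L}^{1/2}`.  For EVERY function `Φ : H(𝔸) → ℝ_{>0}` with `Φ(p x) = modDelta(p) Φ(x)` (`p ∈ P_Δ(𝔸)`),
bounded below by a positive constant on each compact set and satisfying Godement's floor `Φ(γ k) ≤ C_K` (`γ ∈ H(L⁺)`, `k ∈ K` compact), and every
`τ > 2n`:  `Σ_{γ ∈ P_Δ(L⁺)\H(L⁺)} Φ(γ h)^τ < ∞` for all `h ∈ H(𝔸)`.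

THE PROOF (assembly over ★).  (a) ★ `K2LiuSiegelEisensteinDoubledSummable.parabolicIntegral` (E5′, Godement's parabolic integral on
`P_Δ(𝔸) = M_Δ ⋉ N_Δ`, `τ > 2n`) + ★ `lintegral_siegelDomain_ne_top_of_parabolic` (Iwasawa `H(𝔸) = P_Δ(𝔸)·K`, ★ `iwasawaDatumNonempty`) +
★ `summable_height_rpow_of_lintegral_ne_top` (smear, count ≤ integral, unfold) give the count for the CONTINUOUS Plücker height of record `Φ₀`
(★ `exists_siegelHeight_continuous`, K2Liu-p07) — measurability is used for `Φ₀` only.  (b) TRANSFER ★ `summable_rpow_of_comparable`: two heights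
of one type have bounded ratio on `H(𝔸) = P_Δ(𝔸)·K` (`Φ ≤ C_K` on `K` by the floor at `γ = 1`, `Φ₀ ≥ c_K > 0` on `K`), so `Φ ≤ (C_K/c_K)·Φ₀`
everywhere and the count for `Φ₀` dominates the count for `Φ`.  The lower-bound hypothesis (3) of the socket is not even needed.
[Godement, Sém. Bourbaki 257; Garrett (2018) §3.10, proof of Cor. 3.10.2; Moeglin–Waldspurger II.1.5; Liu (2021) Lem. B.10 (2).]

DEGENERATE CORNERS.  `n = 0`: one coset, every family over a subsingleton is summable (and the chain handles it: ★ `parabolicIntegral` has its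
own `n = 0` branch); `dV i = 0 ∕ dW j = 0` are excluded by the binders (the Plücker height needs `gramR₀` invertible); `τ ≤ 2n` is excluded by
hypothesis (Godement's abscissa for `P_Δ ≤ U(n,n)` is sharp); no junk values: `Summable` of a non-negative real family.

HONEST LABEL.  This file pays socket #15b of the U3a line; by itself it retires no named input: `HC_CM` is proved only modulo the 7 printed
citations (2 remaining named inputs: hLiu418 = `stmt-HodgeConjecture-24832`, h413 = `stmt-HodgeConjecture-24833`) until rung 0 closes.
-/

set_option autoImplicit false
-- the mandated namespace repeats the single-problem summit's segment (`HodgeConjecture.HodgeConjecture`)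
set_option linter.dupNamespace false

noncomputable section

open scoped Matrix ENNReal NNReal
open NumberField IsDedekindDomain MeasureTheory Measure

namespace Summit.HodgeConjecture.HodgeConjecture.Cruxes.HLiu418.K2LiuSiegelDeltaHeightCount

open Literature.NumberTheory.Automorphic Literature.NumberTheory.Automorphic.UnitaryGroup Literature.NumberTheory.GaloisRepresentations
open Literature.NumberTheory.GelbartRogawski1991 Literature.NumberTheory.GelbartRogawski1991.GRConstruction
open Literature.NumberTheory.K2Lit.SiegelDoubled
open Literature.MeasureTheory.Group
open Summit.HodgeConjecture.HodgeConjecture.Cruxes.HLiu418.K2LiuIwasawaDatumNonempty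
open Summit.HodgeConjecture.HodgeConjecture.Cruxes.HLiu418.K2LiuSiegelDoubledHeightSmear
open Summit.HodgeConjecture.HodgeConjecture.Cruxes.HLiu418.K2LiuSiegelDoubledCountReduction
open Summit.HodgeConjecture.HodgeConjecture.Cruxes.HLiu418.K2LiuSiegelDoubledUnfold
open Summit.HodgeConjecture.HodgeConjecture.Cruxes.HLiu418.K2LiuSiegelDoubledParabolicReduction
open Summit.HodgeConjecture.HodgeConjecture.Cruxes.HLiu418.K2LiuSiegelDeltaHeightExists
open Summit.HodgeConjecture.HodgeConjecture.Cruxes.HLiu418.K2LiuSiegelEisensteinDoubledSummable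

variable (L : Type) [Field L] [NumberField L] [IsCMField L]
variable {N M n : ℕ} (e : Fin N × Fin M ≃ Fin n)
  (dV : Fin N → L) (hdV : ∀ i, IsCMField.complexConj L (dV i) = dV i)
  (dW : Fin M → L) (hdW : ∀ i, IsCMField.complexConj L (dW i) = dW i)

/-! ## §1 Godement's count for every height of type `(P_Δ, modDelta)` with Godement's floor -/

/-- **GODEMENT'S COUNT, ALL HEIGHTS.**  `dV, dW ≠ 0`; `Φ > 0` on `H(𝔸)` with `Φ(p x) = modDelta(p)·Φ(x)` for `p ∈ P_Δ(𝔸)` and Godement's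
floor `Φ(γ k) ≤ C_K` (`γ ∈ H(L⁺)`, `k` in a compact `K`); `τ > 2n`.  Then `Σ_{q ∈ P_Δ(L⁺)\H(L⁺)} Φ(γ_q h)^τ < ∞` for every `h`.
Proof: the ★ chain of socket #9 for the continuous height of record `Φ₀` (★ `exists_siegelHeight_continuous`: Iwasawa datum ★, E5′
★ `parabolicIntegral`, ★ `lintegral_siegelDomain_ne_top_of_parabolic`, ★ `summable_height_rpow_of_lintegral_ne_top`), then the transfer
★ `summable_rpow_of_comparable` on the Iwasawa compact (`Φ ≤ C` by the floor at `γ = 1`, `Φ₀ ≥ c₀ > 0`).  No measurability of `Φ` is used.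
[cite: Garrett2018, §3.10 (proof of Cor. 3.10.2)] [cite: MoeglinWaldspurger1995, II.1.5] [cite: Liu2021, Lem. B.10 (2) p. 102] -/
theorem summable_height_rpow (hdV0 : ∀ i, dV i ≠ 0) (hdW0 : ∀ i, dW i ≠ 0)
    {Φ : HA L e dV hdV dW hdW → ℝ} (hΦpos : ∀ x, 0 < Φ x)
    (hΦ : ∀ p x : HA L e dV hdV dW hdW, IsSiegelDelta L e dV hdV dW hdW p → Φ (p * x) = modDelta L e dV hdV dW hdW p * Φ x)
    (hΦfloor : ∀ K : Set (HA L e dV hdV dW hdW), IsCompact K → ∃ C : ℝ, ∀ k ∈ K, ∀ γ : ratH L e dV hdV dW hdW,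
      Φ ((γ : HA L e dV hdV dW hdW) * k) ≤ C)
    {τ : ℝ} (hτ : 2 * (n : ℝ) < τ) (h : HA L e dV hdV dW hdW) :
    Summable (fun q : SiegelDeltaQuot L e dV hdV dW hdW =>
      Φ (((Quotient.out q : ratH L e dV hdV dW hdW) : HA L e dV hdV dW hdW) * h) ^ τ) := by
  -- Borel structure and a Haar measure on `H(𝔸)`
  letI : MeasurableSpace (HA L e dV hdV dW hdW) := borel _
  haveI : BorelSpace (HA L e dV hdV dW hdW) := ⟨rfl⟩
  let μ : Measure (HA L e dV hdV dW hdW) := Measure.haar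
  have hτ0 : 0 ≤ τ := le_trans (by positivity) hτ.le
  -- the Iwasawa datum (★ socket «IWASAWA DATUM»)
  obtain ⟨𝒦⟩ := iwasawaDatumNonempty L e dV hdV hdV0 dW hdW hdW0
  -- the continuous height of record (★ #15a) and Godement's count FOR IT (the ★ chain of socket #9)
  obtain ⟨Φ₀, hΦ₀c, hΦ₀pos, hΦ₀, hΦ₀K, hΦ₀floor⟩ := exists_siegelHeight_continuous L e dV hdV dW hdW hdV0 hdW0
  have hΦ₀m : Measurable Φ₀ := hΦ₀c.measurable
  obtain ⟨β', hβ'⟩ := exists_isCoveringWeight_siegelDeltaRat L e dV hdV dW hdW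
  obtain ⟨μP, hμP, w₁, hw₁, hE5'⟩ := parabolicIntegral L e dV hdV dW hdW hdV0 hdW0 τ hτ
  have hE5 := lintegral_siegelDomain_ne_top_of_parabolic L e dV hdV dW hdW μ 𝒦 hΦ₀m hΦ₀pos hΦ₀ hΦ₀K
    (upper_bound_of_floor L e dV hdV dW hdW hΦ₀floor) hτ0 μP hw₁ hE5' hβ'
  have hsum₀ := summable_height_rpow_of_lintegral_ne_top L e dV hdV dW hdW μ 𝒦.isCompact_K 𝒦.iwasawa hΦ₀m hΦ₀pos hΦ₀ hΦ₀K hΦ₀floor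
    hτ0 hβ' hE5 h
  -- transfer `Φ₀ ↦ Φ` through the Iwasawa compact `K`: `Φ ≤ C` on `K` (floor at `γ = 1`), `Φ₀ ≥ c₀ > 0` on `K`
  obtain ⟨C, hC⟩ := upper_bound_of_floor L e dV hdV dW hdW hΦfloor _ 𝒦.isCompact_K
  obtain ⟨c₀, hc₀, hc₀K⟩ := hΦ₀K _ 𝒦.isCompact_K
  exact summable_rpow_of_comparable L e dV hdV dW hdW (K₀ := (𝒦.K : Set (HA L e dV hdV dW hdW))) 𝒦.iwasawa hΦpos hΦ₀pos hΦ hΦ₀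
    hc₀ hC hc₀K hτ0 hsum₀

/-! ## §2 The socket -/

/-- **SOCKET #15b `sig_K2LiuSiegelDeltaHeightCount` (type verbatim): GODEMENT'S COUNT — THE ENGINE.**  For every height `Φ > 0` of type
`(P_Δ, modDelta)` with the compact floor (3) and Godement's floor (4), every `τ > 2n` and every `h ∈ H(𝔸)`:
`Σ_{γ ∈ P_Δ(L⁺)\H(L⁺)} Φ(γ h)^τ < ∞`.  By `summable_height_rpow` (hypothesis (3) is not needed).
[cite: Garrett2018, §3.10] [cite: MoeglinWaldspurger1995, II.1.5] [cite: Liu2021, Lem. B.10 (2) p. 102] -/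
theorem siegelDeltaHeightCount :
    ∀ (L : Type) [Field L] [NumberField L] [IsCMField L] {N M n : ℕ} (e : Fin N × Fin M ≃ Fin n)
      (dV : Fin N → L) (hdV : ∀ i, IsCMField.complexConj L (dV i) = dV i) (_hdV0 : ∀ i, dV i ≠ 0)
      (dW : Fin M → L) (hdW : ∀ i, IsCMField.complexConj L (dW i) = dW i) (_hdW0 : ∀ i, dW i ≠ 0)
      (Φ : HA L e dV hdV dW hdW → ℝ), (∀ x, 0 < Φ x) →
      (∀ p x : HA L e dV hdV dW hdW, IsSiegelDelta L e dV hdV dW hdW p →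
        Φ (p * x) = modDelta L e dV hdV dW hdW p * Φ x) →
      (∀ K : Set (HA L e dV hdV dW hdW), IsCompact K → ∃ c : ℝ, 0 < c ∧ ∀ k ∈ K, c ≤ Φ k) →
      (∀ K : Set (HA L e dV hdV dW hdW), IsCompact K → ∃ C : ℝ, ∀ k ∈ K, ∀ γ : ratH L e dV hdV dW hdW,
        Φ ((γ : HA L e dV hdV dW hdW) * k) ≤ C) →
      ∀ (τ : ℝ), 2 * (n : ℝ) < τ → ∀ (h : HA L e dV hdV dW hdW),
        Summable (fun q : SiegelDeltaQuot L e dV hdV dW hdW =>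
          Φ (((Quotient.out q : ratH L e dV hdV dW hdW) : HA L e dV hdV dW hdW) * h) ^ τ) := by
  intro L _ _ _ N M n e dV hdV hdV0 dW hdW hdW0 Φ hΦpos hΦ _ hΦfloor τ hτ h
  exact summable_height_rpow L e dV hdV dW hdW hdV0 hdW0 hΦpos hΦ hΦfloor hτ h

end Summit.HodgeConjecture.HodgeConjecture.Cruxes.HLiu418.K2LiuSiegelDeltaHeightCount

end
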